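import Mathlib.FieldTheory.IsAlgClosed.AlgebraicClosure
import Literature.AnabelianGeometry.AbsoluteAnabelian.FreeProfiniteCommutatorCusp
import Literature.AnabelianGeometry.AbsoluteAnabelian.FreeProSigmaNonVacuity
import Literature.AnabelianGeometry.AbsoluteAnabelian.AbsTopILem45iModelProofs
import Literature.AnabelianGeometry.AbsoluteAnabelian.AbsTopIII.CcnTransgressionFreeGeom
import Literature.AnabelianGeometry.AbsoluteAnabelian.AbsTopIII.CurveModelProp14iiReduction
import Literature.GroupTheory.ProfiniteSubquotients
import HarnessLib

/-!
# [AbsTopIII] Prop. 1.4 (ii) INHABITED: the once-punctured-torus model of `CurveModel` is a genuine cyclotome presentation at which F-0338 / F-0365 hold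

Mochizuki, *Topics in Absolute Anabelian Geometry III*, §1, Prop. 1.4 (i)/(ii), manuscript p. 31 (lit key
`paper:url-5493eb38cbb7`).  abc-iut-L4-t1's named facts `CurveModel.Prop_1_4_ii_transgression M`
(FACT-LIST F-0338: the differential `Hom_cont(I_x, Ẑ) → H²(Δ_X, Ẑ)` is bijective at every cyclotome
presentation of `M`) and `CurveModel.Prop_1_4_ii_sync M` (F-0365) have REFUTED universal closures
(junk models) and are PROVED at the instance class "`Δ_{U_x} ↠ Δ_X`, `I_x ≤ [Δ_{U_x}, Δ_{U_x}]⁻`,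
`Δ_{U_x}` free profinite" (`CcnTransgressionFreeGeom.lean`, abc-iut-f-076).  The positive kernel witnesses
so far were DEGENERATE (`Δ_X = 1`, where the differential is NOT injective — `CcnTransgressionSplitVanishing`;
or models without cusps, where the facts hold vacuously).  This proof-only file (no definitions) records a
NON-DEGENERATE inhabitant of the instance class — the (g, r) = (1, 1) case of print, profinitely:

* `CurveModel.exists_isCyclotomePresentation_oncePuncturedTorus` — a model `M` over `k = ℚ̄`
  (algebraically closed, so `G_k = 1` and `Π = Δ`: `subsingleton_absoluteGaloisGroup`) with two curves
  `U_x ⊆ X`, `Π_{U_x} := F̂₂ = ⟨a, b⟩^` (profinite completion of the free group on two letters — `π₁` of a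
  once-punctured torus; free pro-{primes} on the letters, abc-iut-w5-d218/f's
  `isFreeProOn_profiniteCompletion_freeGroup`), one cusp `x` with decomposition = inertia group
  `I_x := ⟨[a, b]⟩⁻` (free procyclic: `IsFreeProOn.isFreeProcyclic_topologicalClosure_zpowers_commutator`),
  `Π_X := F̂₂ / ⟨⟨[a, b]⟩⟩⁻` (`π₁` of the torus, profinitely; a profinite group by the tree's
  `ProfiniteSubquotients.totallyDisconnectedSpace_quotient`), `res :=` the quotient map; THEN
  `(U_x ⊆ X, x)` IS a cyclotome presentation (`IsCyclotomePresentation`: the exactness of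
  `1 → I_x → Δ^{c-cn}_{U_x} → Δ_X → 1` reduces by abc-iut's `isCuspidallyCentralExtension_iff_inf_eq_bot` to
  `⟨[a,b]⟩⁻ ∩ [⟨⟨[a,b]⟩⟩⁻, F̂₂]⁻ = 1`, `IsFreeProOn.topologicalClosure_zpowers_commutator_inf_eq_bot`),
  `Δ_X ≠ 1` (the continuous character `F̂₂ → ℤ/2`, `a ↦ 1`, `b ↦ 0` kills `⟨⟨[a,b]⟩⟩⁻` but not `a`),
  a continuous section of `Δ^{c-cn}_{U_x} ↠ Δ_X` EXISTS (`nonempty_ccnSection`), and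
  **`M.Prop_1_4_ii_transgression ∧ M.Prop_1_4_ii_sync`** (by `prop_1_4_ii_transgression_of_isFreePro` /
  `prop_1_4_ii_sync_of_isFreePro`: `Δ_{U_x} ↠ Δ_X` is a quotient map, `I_x ≤ [F̂₂, F̂₂]⁻`, `F̂₂` is free
  profinite).  In particular the differential of Prop. 1.4 (ii) is BIJECTIVE at this presentation:
  `Hom_cont(⟨[a,b]⟩⁻, Ẑ) ≅ H²_cont(F̂₂/⟨⟨[a,b]⟩⟩⁻, Ẑ)` — obtained without computing any cohomology group.

HONEST LABEL: a group-theoretic model (profinite completions of the topological fundamental groups of a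
once-punctured torus and of its compactification, over an algebraically closed base so that `Π = Δ`), not
the étale `π₁` of a scheme (none is constructed in the tree); it shows that the instance class of
F-0338/F-0365 is inhabited by a NON-degenerate presentation, i.e. the instance-class theorems are not
vacuous.  Nothing here bears on [IUTchIII] Cor. 3.12; typed ≠ proved; a witness is consistency evidence,
not an endorsement.
-/

noncomputable section

open CategoryTheory Topology

namespace Literature.AnabelianGeometry.AbsoluteAnabelian.AbsTopIII

open Literature.IUT.HodgeTheaters (profiniteCompletion toCompletion)

/-- Over an algebraically closed field the absolute Galois group is trivial. [folklore] -/
private theorem subsingleton_absoluteGaloisGroup (k : Type) [Field k] [IsAlgClosed k] :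
    Subsingleton (Field.absoluteGaloisGroup k) := by
  refine ⟨fun σ τ => AlgEquiv.ext fun x => ?_⟩
  obtain ⟨a, rfl⟩ :=
    (IsAlgClosed.algebraMap_bijective_of_isIntegral (k := k) (K := AlgebraicClosure k)).2 x
  rw [AlgEquiv.commutes, AlgEquiv.commutes]

/-- For an extension whose Galois group is trivial, `Δ = Π`. [folklore] -/
private theorem geom_eq_top_of_subsingleton (E : FundamentalExtension.{0}) [Subsingleton E.gal] :
    E.geom = ⊤ := by
  rw [eq_top_iff]
  intro x _
  rw [FundamentalExtension.mem_geom]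
  exact Subsingleton.elim _ _

/-- **The once-punctured torus, profinitely, is a GENUINE cyclotome presentation at which [AbsTopIII]
Prop. 1.4 (ii) (F-0338 `Prop_1_4_ii_transgression`, F-0365 `Prop_1_4_ii_sync`) holds NON-VACUOUSLY.**
There is a model `M : CurveModel` over the algebraically closed field `k = ℚ̄` (so `G_k = 1`, `Π = Δ`) with
two curves `U_x ⊆ X`: `Π_{U_x} := F̂₂ = ⟨a, b⟩^` (the profinite completion of the free group on two letters =
`π₁` of a once-punctured torus), one cusp `x` of `U_x` with decomposition = inertia group
`I_x := ⟨[a, b]⟩⁻ ≅ Ẑ`, `Π_X := F̂₂ / ⟨⟨[a, b]⟩⟩⁻` (`π₁` of the torus, `≅ Ẑ²`) and `res :=` the quotient map,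
such that `(U_x ⊆ X, x)` IS a cyclotome presentation (`X` proper, `x` rational, `I_x` free procyclic,
cuspidal kernel = `⟨⟨I_x⟩⟩⁻`, `1 → I_x → Δ^{c-cn}_{U_x} → Δ_X → 1` exact — the injectivity clause being
`⟨[a,b]⟩⁻ ∩ [⟨⟨[a,b]⟩⟩⁻, F̂₂]⁻ = 1`, `FreeProfiniteCommutatorCusp.lean`), `Δ_X ≠ 1`, and BOTH named facts
hold at `M` — by the instance-class theorems `prop_1_4_ii_transgression_of_isFreePro` /
`prop_1_4_ii_sync_of_isFreePro` (`CcnTransgressionFreeGeom.lean`), whose three structural inputs are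
met: `Δ_{U_x} ↠ Δ_X` (a quotient map), `I_x ≤ [Δ_{U_x}, Δ_{U_x}]⁻` (a commutator),
`Δ_{U_x} = F̂₂` free profinite (`isFreeProOn_profiniteCompletion_freeGroup`).  In particular the
differential `Hom_cont(I_x, Ẑ) → H²(Δ_X, Ẑ)` of Prop. 1.4 (ii) is BIJECTIVE here, i.e.
`H²_cont(F̂₂/⟨⟨[a,b]⟩⟩⁻, Ẑ) ≅ Ẑ` — without any cohomology computation.  HONEST LABEL: a group-theoretic
model (the profinite completion of the topological `π₁`'s of a once-punctured torus and its
compactification over an algebraically closed base), not the étale `π₁` of a scheme (none is constructed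
in the tree); it shows the instance class of F-0338/F-0365 is INHABITED by a non-degenerate presentation.
[cite: MochizukiAbsTopIII2015, Prop 1.4 (ii) p.31] -/
theorem CurveModel.exists_isCyclotomePresentation_oncePuncturedTorus :
    ∃ (M : CurveModel.{0}) (Ux X : M.Curve) (h : M.IsCofiniteOpen Ux X) (x : (M.cusps Ux).Cusp),
      M.IsCyclotomePresentation h x ∧ (M.ext X).geom ≠ ⊥ ∧ Nonempty (CcnSection (M.res h)) ∧
        M.Prop_1_4_ii_transgression ∧ M.Prop_1_4_ii_sync := by
  classical
  -- the base field `ℚ̄` and its trivial Galois group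
  haveI : Subsingleton (Field.absoluteGaloisGroup (AlgebraicClosure ℚ)) :=
    subsingleton_absoluteGaloisGroup _
  -- `F̂₂`, free profinite on the two letters
  let P : ProfiniteGrp.{0} := profiniteCompletion (FreeGroup (Fin 2))
  let gens : Fin 2 → P := fun i => toCompletion (FreeGroup (Fin 2)) (FreeGroup.of i)
  have hP : IsFreeProOn P {p : ℕ | p.Prime} gens := isFreeProOn_profiniteCompletion_freeGroup 2
  have hS : ∀ p : ℕ, p.Prime → p ∈ {p : ℕ | p.Prime} := fun p hp => hp
  have h01 : (0 : Fin 2) ≠ 1 := by decide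
  -- the cusp: `c = [a, b]`, `I = ⟨c⟩⁻`, `N = ⟨⟨I⟩⟩⁻`
  let c : P := gens 0 * gens 1 * (gens 0)⁻¹ * (gens 1)⁻¹
  let I : Subgroup P := (Subgroup.zpowers c).topologicalClosure
  let N : Subgroup P := (Subgroup.normalClosure (I : Set P)).topologicalClosure
  have hIc : IsClosed (I : Set P) := Subgroup.isClosed_topologicalClosure _
  have hNc : IsClosed (N : Set P) := Subgroup.isClosed_topologicalClosure _
  haveI hNn : N.Normal := Subgroup.is_normal_topologicalClosure _
  have hIfree : FundamentalExtension.IsFreeProcyclic I :=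
    hP.isFreeProcyclic_topologicalClosure_zpowers_commutator hS h01
  have hIle : I ≤ (⁅(⊤ : Subgroup P), (⊤ : Subgroup P)⁆).topologicalClosure :=
    topologicalClosure_zpowers_commutator_le _ _
  have hIN : I ⊓ (⁅N, (⊤ : Subgroup P)⁆).topologicalClosure = ⊥ :=
    hP.topologicalClosure_zpowers_commutator_inf_eq_bot hS h01
  -- the quotient `F̂₂ / N` as a profinite group
  haveI : TotallyDisconnectedSpace (P ⧸ N) :=
    Literature.GroupTheory.ProfiniteSubquotients.totallyDisconnectedSpace_quotient N hNc
  let Q : ProfiniteGrp.{0} := ProfiniteGrp.of (P ⧸ N)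
  -- the two extensions (`G = G_{ℚ̄} = 1`, augmentation trivial) and the quotient morphism
  let G : ProfiniteGrp.{0} := absoluteGaloisGrp (AlgebraicClosure ℚ)
  let E₁ : FundamentalExtension.{0} :=
    { arith := P, gal := G, aug := 1, aug_surjective := fun g => ⟨1, Subsingleton.elim _ _⟩ }
  let E₀ : FundamentalExtension.{0} :=
    { arith := Q, gal := G, aug := 1, aug_surjective := fun g => ⟨1, Subsingleton.elim _ _⟩ }
  let π : P →ₜ* (P ⧸ N) :=
    { QuotientGroup.mk' N with continuous_toFun := QuotientGroup.continuous_mk }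
  let q : E₁ ⟶ E₀ := ⟨π, ContinuousMonoidHom.id _, fun _ => Subsingleton.elim _ _⟩
  have hE₁ : E₁.geom = ⊤ := geom_eq_top_of_subsingleton E₁
  have hE₀ : E₀.geom = ⊤ := geom_eq_top_of_subsingleton E₀
  -- cusps: one cusp of `U_x` with `D = I`; none on `X`
  let C₁ : E₁.CuspidalData :=
    { Cusp := PUnit
      Dcusp := fun _ => I
      Icusp := fun _ => I ⊓ E₁.geom
      Icusp_eq := fun _ => rfl
      isClosed_Dcusp := fun _ => hIc
      eq_of_conj := fun x y _ _ => Subsingleton.elim x y }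
  let C₀ : E₀.CuspidalData :=
    { Cusp := PEmpty
      Dcusp := fun x => x.elim
      Icusp := fun x => x.elim
      Icusp_eq := fun x => x.elim
      isClosed_Dcusp := fun x => x.elim
      eq_of_conj := fun x => x.elim }
  have hC₁ : ∀ x, C₁.Icusp x = I := fun x => by
    change I ⊓ E₁.geom = I
    rw [hE₁, inf_top_eq]
  -- the model: `Curve = {X, U_x}` (`false ↦ X`, `true ↦ U_x`)
  let M : CurveModel.{0} :=
    { Curve := ULift.{1} Bool
      base := fun _ => AlgebraicClosure ℚ
      ext := fun U => cond U.down E₁ E₀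
      galIso := fun U => by
        rcases U with ⟨_ | _⟩ <;> exact Iso.refl _
      cusps := fun U => by
        rcases U with ⟨_ | _⟩
        exacts [C₀, C₁]
      IsProper := fun U => U = ⟨false⟩
      IsScheme := fun _ => True
      genus := fun _ => 1
      FunctionField := fun _ => AlgebraicClosure ℚ
      Point := fun _ => PEmpty
      decomp := fun _ x => x.elim
      IsNFCurve := fun _ => True
      IsNFPoint := fun _ x => x.elim
      IsNFRational := fun _ _ => True
      IsNFConstant := fun _ _ => True
      NFFunctionField := fun _ => AlgebraicClosure ℚ
      IsStrictlyBelyiType := fun _ => False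
      IsCofiniteOpen := fun U U' => U = ⟨true⟩ ∧ U' = ⟨false⟩
      res := fun {U U'} h => by
        obtain ⟨rfl, rfl⟩ := h
        exact q }
  -- the presentation `(U_x ⊆ X, x)`
  have hpres : M.IsCyclotomePresentation (Ux := ⟨true⟩) (X := ⟨false⟩) ⟨rfl, rfl⟩ PUnit.unit := by
    have hrat : C₁.IsRational PUnit.unit := fun g _ => ⟨1, I.one_mem, Subsingleton.elim _ _⟩
    have hker : cuspidalKernel q = (Subgroup.normalClosure (C₁.Icusp PUnit.unit : Set P)).topologicalClosure := by
      rw [hC₁]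
      change q.arith.toMonoidHom.ker ⊓ E₁.geom = N
      rw [hE₁, inf_top_eq]
      exact QuotientGroup.ker_mk' N
    refine
      { isScheme := ⟨trivial, trivial⟩
        isProper := rfl
        isRational := hrat
        isFreeProcyclic := by
          change FundamentalExtension.IsFreeProcyclic (C₁.Icusp PUnit.unit)
          rw [hC₁]
          exact hIfree
        kernel_eq := hker
        isCuspidallyCentral := ?_ }
    change IsCuspidallyCentralExtension q (C₁.Icusp PUnit.unit)
    rw [isCuspidallyCentralExtension_iff_inf_eq_bot q C₁ PUnit.unit hrat hker]
    unfold cuspidallyCentralModulus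
    rw [hker, hC₁, hE₁]
    exact hIN
  -- every cyclotome presentation of `M` is this one, up to the cusp index: the structural inputs
  have hq : ∀ (Ux X : M.Curve) (h : M.IsCofiniteOpen Ux X) (x : (M.cusps Ux).Cusp),
      M.IsCyclotomePresentation h x →
        Set.SurjOn (M.res h).arith (M.ext Ux).geom (M.ext X).geom := by
    intro Ux X h x _
    obtain ⟨rfl, rfl⟩ := h
    change Set.SurjOn π E₁.geom E₀.geom
    rw [hE₁, hE₀]
    rintro y -
    obtain ⟨g, rfl⟩ := QuotientGroup.mk_surjective y
    exact ⟨g, Subgroup.mem_top g, rfl⟩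
  have hI : ∀ (Ux X : M.Curve) (h : M.IsCofiniteOpen Ux X) (x : (M.cusps Ux).Cusp),
      M.IsCyclotomePresentation h x →
        (M.cusps Ux).Icusp x ≤ (⁅(M.ext Ux).geom, (M.ext Ux).geom⁆).topologicalClosure := by
    intro Ux X h x _
    obtain ⟨rfl, rfl⟩ := h
    change C₁.Icusp x ≤ (⁅E₁.geom, E₁.geom⁆).topologicalClosure
    rw [hC₁, hE₁]
    exact hIle
  have hfree : ∀ (Ux X : M.Curve) (h : M.IsCofiniteOpen Ux X) (x : (M.cusps Ux).Cusp),
      M.IsCyclotomePresentation h x → IsFreePro (M.ext Ux).geom {p : ℕ | p.Prime} := by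
    intro Ux X h x _
    obtain ⟨rfl, rfl⟩ := h
    change IsFreePro E₁.geom {p : ℕ | p.Prime}
    rw [hE₁]
    let e : P ≃ₜ* (⊤ : Subgroup P) :=
      { Subgroup.topEquiv.symm with
        continuous_toFun := Continuous.subtype_mk continuous_id _
        continuous_invFun := continuous_subtype_val }
    exact ⟨2, _, hP.of_continuousMulEquiv e⟩
  refine ⟨M, ⟨true⟩, ⟨false⟩, ⟨rfl, rfl⟩, PUnit.unit, hpres, ?_,
    nonempty_ccnSection _ (hq _ _ _ _ hpres),
    M.prop_1_4_ii_transgression_of_isFreePro hS hq hI hfree,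
    M.prop_1_4_ii_sync_of_isFreePro hS hq hI hfree⟩
  -- `Δ_X = F̂₂ / N ≠ 1`: the class of `a` is nontrivial, as `a ∉ N ≤ [P, P]⁻` — via the continuous
  -- character `F̂₂ → ℤ/2` killing `b` (it kills every commutator, hence `N`, but not `a`)
  change E₀.geom ≠ ⊥
  rw [hE₀]
  intro htop
  have ha : (QuotientGroup.mk (gens 0) : P ⧸ N) = 1 := by
    have := (Subgroup.eq_bot_iff_forall _).mp htop (QuotientGroup.mk (gens 0)) (Subgroup.mem_top _)
    exact this
  rw [QuotientGroup.eq_one_iff] at ha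
  -- a continuous character to `ℤ/2` with `a ↦ 1`, `b ↦ 0`
  letI : TopologicalSpace (Multiplicative (ZMod 2)) := ⊥
  haveI : DiscreteTopology (Multiplicative (ZMod 2)) := ⟨rfl⟩
  obtain ⟨χ, hχc, hχa, hχb⟩ := hP.exists_continuous_hom_pair hS h01 (Multiplicative (ZMod 2))
    (Multiplicative.ofAdd 1) 1
  have hχI : I.map χ = ⊥ := by
    rw [eq_bot_iff]
    have h1 : I ≤ χ.ker.topologicalClosure := by
      refine Subgroup.topologicalClosure_mono ?_
      rw [Subgroup.zpowers_le, MonoidHom.mem_ker]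
      simp only [c, map_mul, map_inv, hχa, hχb, mul_one, inv_one, mul_inv_cancel]
    have hcl : IsClosed (χ.ker : Set P) := by
      rw [MonoidHom.coe_ker]
      exact (isClosed_discrete _).preimage hχc
    have h2 : χ.ker.topologicalClosure = χ.ker :=
      le_antisymm (Subgroup.topologicalClosure_minimal _ le_rfl hcl) (Subgroup.le_topologicalClosure _)
    rw [h2] at h1
    rintro _ ⟨g, hg, rfl⟩
    exact h1 hg
  have hχN : N ≤ χ.ker := by
    have hcl : IsClosed (χ.ker : Set P) := by
      rw [MonoidHom.coe_ker]
      exact (isClosed_discrete _).preimage hχc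
    refine Subgroup.topologicalClosure_minimal _ ?_ hcl
    refine Subgroup.normalClosure_le_normal ?_
    intro g hg
    rw [SetLike.mem_coe, MonoidHom.mem_ker, ← Subgroup.mem_bot, ← hχI]
    exact Subgroup.mem_map_of_mem χ hg
  have := hχN ha
  rw [MonoidHom.mem_ker, hχa] at this
  exact absurd this (by decide)

end Literature.AnabelianGeometry.AbsoluteAnabelian.AbsTopIII
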